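import Mathlib
import HarnessLib
import Summits.NavierStokesRegularity.NavierStokesRegularity.Theorems.HalfSpaceWindowDoorCirculationCarryingRigidityMovingLiouville
import Summits.NavierStokesRegularity.NavierStokesRegularity.Theorems.HalfSpaceWindowDoorCirculationCarryingRigidityEddyStrata

/-!
# Route `HalfSpaceWindowDoor`, crux `CirculationCarryingRigidity` (stmt-NavierStokesRegularity-25311) — line `eddy_covariance`:
# THE RESIDUE OF W6 after g10, MOVING-FRAME form (all similarity-fixed vertical axes), and the PORTRAIT of the enemy

LEAD ns-hsw-p1 g10, `--supports 25311 --as helper`; card `Cruxes/…/Lines/eddy_covariance.md`.  `…QuietStrata` with the fixed axis replaced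
by a similarity-fixed one (`…MovingLiouville` ∘ `…EddyStrata.remainder_le_eddyLift_add` on the door-class translate of each slice).  With
`W(t,x) = v(t, x + √(−t)y₀)` and all circle functionals those of `W` (circles centred at `x_h = √(−t)y₀`):
* `inner_curl_e3_eq_zero_of_movingEddyLiftBound` / `hemisphereLiouvilleE3_of_movingEddyLiftBound` — **W6 HOLDS AS SOON AS** every
  closed-hemisphere door-class profile admits `y₀ ∈ ℝ³`, `B, R₀ ≥ 0`, `σ₀ < 0`, `η₀ > 0` such that the EDDY-LIFT bound
  `∮ (v_z − v̄_z) ω_r dl ≤ (B/√(−t)) (∮ω₃ dl + |∮ω_r dl|)` holds at every `t ≤ σ₀` on every circle about the axis `x_h = √(−t)y₀` which is FAR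
  (`r ≥ R₀√(−t)`), a RECORD (w.r.t. `R₁ = 4(B + 3C + ‖y₀‖/2) + R₀ + 1 + 8πC/η₀`), QUIET (`(−t)∮ω₃ dl ≤ η₀r`, `(−t)|∮ω_r dl| ≤ η₀r`) and GROWING.
* `enemy_portrait_moving` — a circulation-carrying closed-hemisphere door-class profile violates this about EVERY similarity-fixed axis, for all
  `B, R₀, η₀` and every epoch: there is always a far, quiet, growing record circle about `x_h = √(−t)y₀` into which the eddy lift pumps
  vertical-vorticity flux faster than `(B/√(−t))(∮ω₃ dl + |∮ω_r dl|)`.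
WHAT THIS IS NOT: not about NS regularity (Clay A); HYPOTHETICAL blow-up profiles (KNSS ancient mild solutions); the item stays OPEN at its
research stub `stub_layerExclusion ≡ HemisphereLiouvilleE3`; nothing is closed by this file.
-/

noncomputable section

-- the summit and its single sub-problem share the name (CONVENTIONS §1), as in every Theorems file
set_option linter.dupNamespace false

namespace Summit.NavierStokesRegularity.NavierStokesRegularity.Theorems.HalfSpaceWindowDoorCirculationCarryingRigidityMovingStrata

open MeasureTheory Set Function Filter Topology InnerProductSpace
open scoped RealInnerProductSpace InnerProductSpace
open Literature.Analysis Literature.Analysis.UnboundedOperators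
open Literature.Analysis.FluidPDE hiding eR
open Summit.NavierStokesRegularity.NavierStokesRegularity.Theorems.HalfSpaceWindowDoorCirculationCarryingRigidityDefs
  (InDoorClass SignE3 e3 HemisphereLiouvilleE3)
open Summit.NavierStokesRegularity.NavierStokesRegularity.Theorems.AxisTwistDoorAveragedConeLiouvilleDefs
  (cylPt eR circ vortCirc radVortCirc meanZ remainder)
open Summit.NavierStokesRegularity.NavierStokesRegularity.Theorems.AveragedConeLiouville.CircMonotone (vortCirc_nonneg)
open Summit.NavierStokesRegularity.NavierStokesRegularity.Theorems.HalfSpaceWindowDoorCirculationCarryingRigidityConeFluxSubsolution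
  (signE3_atd)
open Summit.NavierStokesRegularity.NavierStokesRegularity.Theorems.HalfSpaceWindowDoorCirculationCarryingRigidityEddyStrata
  (remainder_le_eddyLift_add)
open Summit.NavierStokesRegularity.NavierStokesRegularity.Theorems.HalfSpaceWindowDoorCirculationCarryingRigidityMovingLiouville
  (inner_curl_e3_eq_zero_of_movingEddyBound)
open Summit.NavierStokesRegularity.NavierStokesRegularity.Theorems.HalfSpaceWindowDoorCirculationCarryingRigidityMovingFrame
  (inDoorClass_translate signE3_translate)

-- AxisTwistDoor's `e₃` (the same vector as the route's `Defs.e3`) under the name `e3A`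
open Summit.NavierStokesRegularity.NavierStokesRegularity.Theorems.AxisTwistDoorAveragedConeLiouvilleDefs renaming e3 → e3A

variable {C : ℝ} {v : ℝ → EuclideanSpace ℝ (Fin 3) → EuclideanSpace ℝ (Fin 3)}

/-- **W6 ⟸ THE EDDY-LIFT BOUND ON QUIET, GROWING RECORD FAR CIRCLES ABOUT A SIMILARITY-FIXED AXIS** (residue of W6 after g10). -/
theorem inner_curl_e3_eq_zero_of_movingEddyLiftBound (hv : InDoorClass C v) (hsign : SignE3 v) (y₀ : EuclideanSpace ℝ (Fin 3))
    {B : ℝ} (hB : 0 ≤ B)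
    {R₀ : ℝ} (hR₀ : 0 ≤ R₀) {σ₀ : ℝ} (hσ₀ : σ₀ < 0) {η₀ : ℝ} (hη : 0 < η₀)
    (hE : ∀ t : ℝ, t ≤ σ₀ → ∀ r : ℝ, R₀ * Real.sqrt (-t) ≤ r → ∀ z : ℝ,
      (∀ s' : ℝ, s' ≤ t → ∀ z' : ℝ,
        circ (fun τ x => v τ (x + Real.sqrt (-τ) • y₀)) ((4 * (B + 2 * C + ‖y₀‖ / 2 + C) + R₀ + 1 + 8 * Real.pi * C / η₀) * Real.sqrt (-s')) z' s' < circ (fun τ x => v τ (x + Real.sqrt (-τ) • y₀)) r z t) →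
      (-t) * vortCirc (fun τ x => v τ (x + Real.sqrt (-τ) • y₀)) r z t ≤ η₀ * r → (-t) * |radVortCirc (fun τ x => v τ (x + Real.sqrt (-τ) • y₀)) r z t| ≤ η₀ * r →
      0 < deriv (fun σ => circ (fun τ x => v τ (x + Real.sqrt (-τ) • y₀)) r z σ) t →
      (∫ θ in (0 : ℝ)..(2 * Real.pi), (⟪v t (cylPt r θ z + Real.sqrt (-t) • y₀), e3A⟫ - meanZ (fun τ x => v τ (x + Real.sqrt (-τ) • y₀)) r z t) * ⟪curl (fun x => v t (x + Real.sqrt (-t) • y₀)) (cylPt r θ z), eR θ⟫ * r) ≤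
        B / Real.sqrt (-t) * (vortCirc (fun τ x => v τ (x + Real.sqrt (-τ) • y₀)) r z t + |radVortCirc (fun τ x => v τ (x + Real.sqrt (-τ) • y₀)) r z t|)) :
    ∀ s < 0, ∀ y, ⟪curl (v s) y, e3⟫ = 0 := by
  have hC : 0 ≤ C := HalfSpaceWindowDoorCirculationCarryingRigidityConeFluxSubsolution.typeI_const_nonneg hv
  have hB' : 0 ≤ B + 2 * C := by positivity
  refine inner_curl_e3_eq_zero_of_movingEddyBound hv hsign y₀ hB' hR₀ hσ₀ hη fun t ht r hr z hrec h1 h2 h3 => ?_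
  have ht0 : t < 0 := lt_of_le_of_lt ht hσ₀
  have hsq : 0 < Real.sqrt (-t) := Real.sqrt_pos.2 (neg_pos.2 ht0)
  have hr0 : 0 ≤ r := le_trans (by positivity) hr
  have hwt := inDoorClass_translate hv (Real.sqrt (-t) • y₀)
  have hst := signE3_translate hsign (Real.sqrt (-t) • y₀)
  have h5 : remainder (fun τ x => v τ (x + Real.sqrt (-τ) • y₀)) r z t ≤
      (∫ θ in (0 : ℝ)..(2 * Real.pi), (⟪v t (cylPt r θ z + Real.sqrt (-t) • y₀), e3A⟫ -
          meanZ (fun τ x => v τ (x + Real.sqrt (-τ) • y₀)) r z t) *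
        ⟪curl (fun x => v t (x + Real.sqrt (-t) • y₀)) (cylPt r θ z), eR θ⟫ * r) +
      2 * C / Real.sqrt (-t) * vortCirc (fun τ x => v τ (x + Real.sqrt (-τ) • y₀)) r z t :=
    remainder_le_eddyLift_add hwt hst ht0 hr0 z
  have h6 := hE t ht r hr z hrec h1 h2 h3
  have hΓr : 0 ≤ vortCirc (fun τ x => v τ (x + Real.sqrt (-τ) • y₀)) r z t :=
    vortCirc_nonneg (fun τ x => v τ (x + Real.sqrt (-t) • y₀)) (signE3_atd hst) ht0 hr0 _
  have e : (B + 2 * C) / Real.sqrt (-t) * (vortCirc (fun τ x => v τ (x + Real.sqrt (-τ) • y₀)) r z t + |radVortCirc (fun τ x => v τ (x + Real.sqrt (-τ) • y₀)) r z t|) =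
      B / Real.sqrt (-t) * (vortCirc (fun τ x => v τ (x + Real.sqrt (-τ) • y₀)) r z t + |radVortCirc (fun τ x => v τ (x + Real.sqrt (-τ) • y₀)) r z t|) + 2 * C / Real.sqrt (-t) * vortCirc (fun τ x => v τ (x + Real.sqrt (-τ) • y₀)) r z t +
        2 * C / Real.sqrt (-t) * |radVortCirc (fun τ x => v τ (x + Real.sqrt (-τ) • y₀)) r z t| := by
    field_simp
    ring
  rw [e]
  have : 0 ≤ 2 * C / Real.sqrt (-t) * |radVortCirc (fun τ x => v τ (x + Real.sqrt (-τ) • y₀)) r z t| := by positivity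
  linarith

/-- **BY-NAME REDUCTION of W6 to the eddy-lift bound on quiet, growing record far circles about SOME similarity-fixed axis.** -/
theorem hemisphereLiouvilleE3_of_movingEddyLiftBound
    (H : ∀ (C : ℝ) (v : ℝ → EuclideanSpace ℝ (Fin 3) → EuclideanSpace ℝ (Fin 3)), InDoorClass C v → SignE3 v →
      ∃ y₀ : EuclideanSpace ℝ (Fin 3), ∃ B : ℝ, 0 ≤ B ∧ ∃ R₀ : ℝ, 0 ≤ R₀ ∧ ∃ σ₀ : ℝ, σ₀ < 0 ∧ ∃ η₀ : ℝ, 0 < η₀ ∧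
        ∀ t : ℝ, t ≤ σ₀ → ∀ r : ℝ, R₀ * Real.sqrt (-t) ≤ r → ∀ z : ℝ,
          (∀ s' : ℝ, s' ≤ t → ∀ z' : ℝ,
            circ (fun τ x => v τ (x + Real.sqrt (-τ) • y₀)) ((4 * (B + 2 * C + ‖y₀‖ / 2 + C) + R₀ + 1 + 8 * Real.pi * C / η₀) * Real.sqrt (-s')) z' s' < circ (fun τ x => v τ (x + Real.sqrt (-τ) • y₀)) r z t) →
          (-t) * vortCirc (fun τ x => v τ (x + Real.sqrt (-τ) • y₀)) r z t ≤ η₀ * r → (-t) * |radVortCirc (fun τ x => v τ (x + Real.sqrt (-τ) • y₀)) r z t| ≤ η₀ * r →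
          0 < deriv (fun σ => circ (fun τ x => v τ (x + Real.sqrt (-τ) • y₀)) r z σ) t →
          (∫ θ in (0 : ℝ)..(2 * Real.pi), (⟪v t (cylPt r θ z + Real.sqrt (-t) • y₀), e3A⟫ - meanZ (fun τ x => v τ (x + Real.sqrt (-τ) • y₀)) r z t) * ⟪curl (fun x => v t (x + Real.sqrt (-t) • y₀)) (cylPt r θ z), eR θ⟫ * r) ≤
            B / Real.sqrt (-t) * (vortCirc (fun τ x => v τ (x + Real.sqrt (-τ) • y₀)) r z t + |radVortCirc (fun τ x => v τ (x + Real.sqrt (-τ) • y₀)) r z t|)) :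
    HemisphereLiouvilleE3 := by
  intro C v hrate hcont hmild hdiv hnn
  have hv : InDoorClass C v := ⟨hrate, hcont, hmild, hdiv⟩
  obtain ⟨y₀, B, hB, R₀, hR₀, σ₀, hσ₀, η₀, hη, hE⟩ := H C v hv hnn
  exact inner_curl_e3_eq_zero_of_movingEddyLiftBound hv hnn y₀ hB hR₀ hσ₀ hη hE

/-- **PORTRAIT OF THE ENEMY (census reading after g10, all similarity-fixed axes).**  A circulation-carrying closed-hemisphere door-class
profile has, for EVERY `y₀ ∈ ℝ³`, ALL `B, R₀ ≥ 0`, `η₀ > 0` and EVERY epoch `σ₀ < 0`, a time `t ≤ σ₀` and a circle about the axis `x_h = √(−t)y₀`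
which is FAR, a RECORD, QUIET and GROWING, into which the EDDY LIFT pumps flux faster than `(B/√(−t))(∮ω₃ dl + |∮ω_r dl|)`. -/
theorem enemy_portrait_moving (hv : InDoorClass C v) (hsign : SignE3 v) (hpos : ∃ σ < 0, ∃ y, 0 < ⟪curl (v σ) y, e3⟫)
    (y₀ : EuclideanSpace ℝ (Fin 3)) {B : ℝ} (hB : 0 ≤ B) {R₀ : ℝ} (hR₀ : 0 ≤ R₀) {σ₀ : ℝ} (hσ₀ : σ₀ < 0) {η₀ : ℝ} (hη : 0 < η₀) :
    ∃ t : ℝ, t ≤ σ₀ ∧ ∃ r : ℝ, R₀ * Real.sqrt (-t) ≤ r ∧ ∃ z : ℝ,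
      (∀ s' : ℝ, s' ≤ t → ∀ z' : ℝ,
        circ (fun τ x => v τ (x + Real.sqrt (-τ) • y₀)) ((4 * (B + 2 * C + ‖y₀‖ / 2 + C) + R₀ + 1 + 8 * Real.pi * C / η₀) * Real.sqrt (-s')) z' s' < circ (fun τ x => v τ (x + Real.sqrt (-τ) • y₀)) r z t) ∧
      (-t) * vortCirc (fun τ x => v τ (x + Real.sqrt (-τ) • y₀)) r z t ≤ η₀ * r ∧ (-t) * |radVortCirc (fun τ x => v τ (x + Real.sqrt (-τ) • y₀)) r z t| ≤ η₀ * r ∧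
      0 < deriv (fun σ => circ (fun τ x => v τ (x + Real.sqrt (-τ) • y₀)) r z σ) t ∧
      B / Real.sqrt (-t) * (vortCirc (fun τ x => v τ (x + Real.sqrt (-τ) • y₀)) r z t + |radVortCirc (fun τ x => v τ (x + Real.sqrt (-τ) • y₀)) r z t|) <
        ∫ θ in (0 : ℝ)..(2 * Real.pi), (⟪v t (cylPt r θ z + Real.sqrt (-t) • y₀), e3A⟫ - meanZ (fun τ x => v τ (x + Real.sqrt (-τ) • y₀)) r z t) * ⟪curl (fun x => v t (x + Real.sqrt (-t) • y₀)) (cylPt r θ z), eR θ⟫ * r := by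
  by_contra h
  push Not at h
  obtain ⟨σ, hσ, y, hy⟩ := hpos
  have h0 := inner_curl_e3_eq_zero_of_movingEddyLiftBound hv hsign y₀ hB hR₀ hσ₀ hη
    (fun t ht r hr z hrec h1 h2 h3 => h t ht r hr z hrec h1 h2 h3) σ hσ y
  exact hy.ne' h0

/-- **THE CRUX ⟸ THE RESIDUE (moving frame, eddy-lift form).**  `CirculationCarryingRigidity` (every direction `e ≠ 0`) holds as soon as
every closed-hemisphere door-class profile obeys, about SOME similarity-fixed vertical axis `y₀` and for SOME `B, R₀ ≥ 0`, `σ₀ < 0`, `η₀ > 0`,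
the eddy-lift bound on its quiet growing record far circles at the times `≤ σ₀` (rotation covariance `…Rotate.stub_rotate` ∘
`hemisphereLiouvilleE3_of_movingEddyLiftBound`). -/
theorem circulationCarryingRigidity_of_movingEddyLiftBound
    (H : ∀ (C : ℝ) (v : ℝ → EuclideanSpace ℝ (Fin 3) → EuclideanSpace ℝ (Fin 3)), InDoorClass C v → SignE3 v →
      ∃ y₀ : EuclideanSpace ℝ (Fin 3), ∃ B : ℝ, 0 ≤ B ∧ ∃ R₀ : ℝ, 0 ≤ R₀ ∧ ∃ σ₀ : ℝ, σ₀ < 0 ∧ ∃ η₀ : ℝ, 0 < η₀ ∧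
        ∀ t : ℝ, t ≤ σ₀ → ∀ r : ℝ, R₀ * Real.sqrt (-t) ≤ r → ∀ z : ℝ,
          (∀ s' : ℝ, s' ≤ t → ∀ z' : ℝ,
            circ (fun τ x => v τ (x + Real.sqrt (-τ) • y₀))
                ((4 * (B + 2 * C + ‖y₀‖ / 2 + C) + R₀ + 1 + 8 * Real.pi * C / η₀) * Real.sqrt (-s')) z' s' <
              circ (fun τ x => v τ (x + Real.sqrt (-τ) • y₀)) r z t) →
          (-t) * vortCirc (fun τ x => v τ (x + Real.sqrt (-τ) • y₀)) r z t ≤ η₀ * r →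
          (-t) * |radVortCirc (fun τ x => v τ (x + Real.sqrt (-τ) • y₀)) r z t| ≤ η₀ * r →
          0 < deriv (fun σ => circ (fun τ x => v τ (x + Real.sqrt (-τ) • y₀)) r z σ) t →
          (∫ θ in (0 : ℝ)..(2 * Real.pi), (⟪v t (cylPt r θ z + Real.sqrt (-t) • y₀), e3A⟫ -
              meanZ (fun τ x => v τ (x + Real.sqrt (-τ) • y₀)) r z t) *
            ⟪curl (fun x => v t (x + Real.sqrt (-t) • y₀)) (cylPt r θ z), eR θ⟫ * r) ≤
            B / Real.sqrt (-t) * (vortCirc (fun τ x => v τ (x + Real.sqrt (-τ) • y₀)) r z t +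
              |radVortCirc (fun τ x => v τ (x + Real.sqrt (-τ) • y₀)) r z t|)) :
    Summit.NavierStokesRegularity.NavierStokesRegularity.Theses.HalfSpaceWindowDoor.CirculationCarryingRigidity :=
  HalfSpaceWindowDoorCirculationCarryingRigidityRotate.stub_rotate (hemisphereLiouvilleE3_of_movingEddyLiftBound H)

end Summit.NavierStokesRegularity.NavierStokesRegularity.Theorems.HalfSpaceWindowDoorCirculationCarryingRigidityMovingStrata

end
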